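import Summits.Ventures.PercRepro.ProfileGapMonoThresholdTopNuTwoCount

/-!
# PercRepro — THE TOP THRESHOLD OF THE CO-RANK-4 FAMILY HOLDS ON EVERY COLOOP-FREE MATROID WITH A PLANE OF `ν + 2`
POINTS (p5, gen 30; `proofs/P5-GM1.md` §41(d); announced INBOX 13953)

With the two counts of ProfileGapMonoThresholdTopNuTwoCount (`A + s · Bℓ` demanding sets, each with complement rank
exactly `R`; `s · A₂ + C(s,2) · (Bℓ or C₂)` targets), COMPLEMENTATION `D ↦ F ∖ D` on the subsets of the plane gives
`Bℓ ≤ A₂` (`card_Bl_le_A2`: a rank-`2` set with spanning complement is the complement of a spanning set whose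
complement has rank `2`), `A ≤ A₂` (`card_A_le_A2`: `ρ(O ∪ (F ∖ D)) = #O + 2` forces `ρ(F ∖ D) ≥ 2`) and, for `s = 2`,
`A = C₂` (`card_A_eq_C2`); the threshold sum at `t = R − 1` is `R · (A + s · Bℓ)` (`thresholdSum_top_eq`), and the
arithmetic closes for `s = 2` (`4(A + 2Bℓ) ≤ 4(2A₂ + A)`), `s = 3` (`5(A + 3Bℓ) ≤ 4(3A₂ + 3Bℓ)`) and `s ≥ 4`
(`s + 2 ≤ 2(s − 1)`): **`thresholdIneq_four_top_of_long_plane`** — `ThresholdIneq N 4 (ρ(E) − 1)`, i.e.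
`Σ_{ρ(B) = 3, ρ(E ∖ B) = ρ(E)} ρ(E) ≤ 4 · #{S : ρ(S) = 4, ρ(E ∖ S) ≥ ρ(E) − 1}`, on every coloop-free matroid of rank
`≥ 4` with a plane of `ν + 2` points.  The first theorem of the co-rank-`4` family beyond the regimes without a long
flat (§39(a)); for `ρ(E) = 4` it is the row `(3, 4)` on every rank-`4` matroid with a plane of `ν + 2` points.
Nothing open is asserted.
-/

open scoped Matroid

namespace PercRepro.Cogirth

open Finset ThmH Skew Shadow Profile

variable {α : Type} [DecidableEq α]

section Complementation

variable {N : Matroid α} [N.Finite]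

/-- **`Bℓ ≤ A₂` by complementation** `D ↦ F ∖ D`: a rank-`2` set with spanning complement is the complement of a
spanning set whose complement has rank `2`. -/
theorem card_Bl_le_A2 (B : Finset α) :
    ((clF N B).powerset.filter (fun D => rk N D = 2 ∧ rk N (clF N B \ D) = 3)).card ≤
      ((clF N B).powerset.filter (fun D => rk N D = 3 ∧ 2 ≤ rk N (clF N B \ D))).card := by
  apply card_le_card_of_injOn (fun D => clF N B \ D)
  · intro D hD
    simp only [coe_filter, Set.mem_setOf_eq, mem_powerset] at hD ⊢
    obtain ⟨hDF, h2, h3⟩ := hD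
    refine ⟨sdiff_subset, h3, ?_⟩
    rw [Finset.sdiff_sdiff_eq_self hDF, h2]
  · intro D₁ hD₁ D₂ hD₂ heq
    simp only [coe_filter, Set.mem_setOf_eq, mem_powerset] at hD₁ hD₂
    simp only at heq
    rw [← Finset.sdiff_sdiff_eq_self hD₁.1, heq, Finset.sdiff_sdiff_eq_self hD₂.1]

/-- **`A ≤ A₂`**: `ρ(O ∪ (F ∖ D)) = ρ(E) = #O + 2` forces `ρ(F ∖ D) ≥ 2`. -/
theorem card_A_le_A2 (B : Finset α) (hs : (gr N \ clF N B).card + 2 = rk N (gr N)) :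
    ((clF N B).powerset.filter
        (fun D => rk N D = 3 ∧ rk N ((gr N \ clF N B) ∪ (clF N B \ D)) = rk N (gr N))).card ≤
      ((clF N B).powerset.filter (fun D => rk N D = 3 ∧ 2 ≤ rk N (clF N B \ D))).card := by
  apply card_le_card
  intro D hD
  rw [mem_filter] at hD ⊢
  obtain ⟨hDF, h3, hO⟩ := hD
  refine ⟨hDF, h3, ?_⟩
  have h1 := rk_union_le (M := N) (gr N \ clF N B) (clF N B \ D)
  have h2 := rk_le_card (M := N) (gr N \ clF N B)
  omega

/-- **`A = C₂` when `s = 2`** (`ρ(E) = 4`), by complementation `D ↦ F ∖ D`. -/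
theorem card_A_eq_C2 (B : Finset α) (hR : rk N (gr N) = 4) :
    ((clF N B).powerset.filter
        (fun D => rk N D = 3 ∧ rk N ((gr N \ clF N B) ∪ (clF N B \ D)) = rk N (gr N))).card =
      ((clF N B).powerset.filter
        (fun D => rk N ((gr N \ clF N B) ∪ D) = 4 ∧ rk N (clF N B \ D) = 3)).card := by
  apply card_bij (fun D _ => clF N B \ D)
  · intro D hD
    rw [mem_filter, mem_powerset] at hD ⊢
    obtain ⟨hDF, h3, hO⟩ := hD
    refine ⟨sdiff_subset, ?_, ?_⟩
    · rw [← hR]; exact hO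
    · rw [Finset.sdiff_sdiff_eq_self hDF, h3]
  · intro D₁ hD₁ D₂ hD₂ heq
    rw [mem_filter, mem_powerset] at hD₁ hD₂
    rw [← Finset.sdiff_sdiff_eq_self hD₁.1, heq, Finset.sdiff_sdiff_eq_self hD₂.1]
  · intro D' hD'
    rw [mem_filter, mem_powerset] at hD'
    obtain ⟨hD'F, h4, h3⟩ := hD'
    refine ⟨clF N B \ D', ?_, Finset.sdiff_sdiff_eq_self hD'F⟩
    rw [mem_filter, mem_powerset]
    refine ⟨sdiff_subset, h3, ?_⟩
    rw [Finset.sdiff_sdiff_eq_self hD'F, hR]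
    exact h4

/-- **The threshold sum at the top threshold** is `ρ(E)` times the number of rank-`3` sets with spanning complement
(`1 ≤ ρ(E)`). -/
theorem thresholdSum_top_eq (N : Matroid α) [N.Finite] (hR : 1 ≤ rk N (gr N)) :
    thresholdSum N 4 (rk N (gr N) - 1) =
      rk N (gr N) * ((Rq N 3).filter (fun X => rk N (gr N \ X) = rk N (gr N))).card := by
  unfold thresholdSum
  have hq : (4 : ℕ) - 1 = 3 := by norm_num
  rw [hq]
  have hcongr : ∀ B ∈ Rq N 3,
      (if rk N (gr N) - 1 + 1 ≤ rk N (gr N \ B) then rk N (gr N \ B) else 0) =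
        if rk N (gr N \ B) = rk N (gr N) then rk N (gr N) else 0 := by
    intro B _
    have hle : rk N (gr N \ B) ≤ rk N (gr N) := rk_mono' sdiff_subset
    by_cases h : rk N (gr N \ B) = rk N (gr N)
    · rw [if_pos h, if_pos (by omega)]
      exact h
    · rw [if_neg h, if_neg (by omega)]
  rw [sum_congr rfl hcongr, ← sum_filter, sum_const, smul_eq_mul, mul_comm]

/-- `2 · C(s, 2) = s (s − 1)`. -/
theorem two_mul_choose_two (s : ℕ) : 2 * s.choose 2 = s * (s - 1) := by
  rw [Nat.choose_two_right]
  exact Nat.two_mul_div_two_of_even (Nat.even_mul_pred_self s)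

/-- **THE TOP THRESHOLD OF THE CO-RANK-4 FAMILY ON A MATROID WITH A PLANE OF `ν + 2` POINTS**: for a coloop-free
`N` of rank `ρ(E) ≥ 4` with `B ∈ Rq N 3` and `#(cl B) + ρ(E) = #E + 2`, `ThresholdIneq N 4 (ρ(E) − 1)` —
`Σ_{ρ(B) = 3, ρ(E ∖ B) = ρ(E)} ρ(E) ≤ 4 · #{S : ρ(S) = 4, ρ(E ∖ S) ≥ ρ(E) − 1}`. -/
theorem thresholdIneq_four_top_of_long_plane (hcf : ∀ z ∈ gr N, rk N ((gr N).erase z) = rk N (gr N))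
    {B : Finset α} (hB : B ∈ Rq N 3) (hlong : (clF N B).card + rk N (gr N) = (gr N).card + 2)
    (hR : 4 ≤ rk N (gr N)) : ThresholdIneq N 4 (rk N (gr N) - 1) := by
  unfold ThresholdIneq
  rw [thresholdSum_top_eq N (by omega), card_top_demanding hcf hB hlong hR, card_top_targets hcf hB hlong hR]
  have hs := card_sdiff_add_two_eq_rk hlong
  have hBl := card_Bl_le_A2 (N := N) B
  have hA := card_A_le_A2 (N := N) B hs
  set A := ((clF N B).powerset.filter
    (fun D => rk N D = 3 ∧ rk N ((gr N \ clF N B) ∪ (clF N B \ D)) = rk N (gr N))).card with hAdef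
  set A2 := ((clF N B).powerset.filter (fun D => rk N D = 3 ∧ 2 ≤ rk N (clF N B \ D))).card with hA2def
  set Bl := ((clF N B).powerset.filter (fun D => rk N D = 2 ∧ rk N (clF N B \ D) = 3)).card with hBldef
  set C2 := ((clF N B).powerset.filter
    (fun D => rk N ((gr N \ clF N B) ∪ D) = 4 ∧ rk N (clF N B \ D) = 3)).card with hC2def
  set s := (gr N \ clF N B).card with hsdef
  set R := rk N (gr N) with hRdef
  by_cases hs2 : s = 2
  · -- `s = 2`: `A = C₂` and `Bℓ ≤ A₂`
    have hAC : A = C2 := card_A_eq_C2 (N := N) B (by omega)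
    rw [if_pos hs2, hs2, ← hAC]
    have hR4 : R = 4 := by omega
    rw [hR4]
    norm_num
    omega
  rw [if_neg hs2]
  by_cases hs3 : s = 3
  · rw [hs3]
    have hR5 : R = 5 := by omega
    rw [hR5]
    norm_num
    omega
  · -- `s ≥ 4`: `s + 2 ≤ 2(s − 1)`
    have hs4 : 4 ≤ s := by omega
    have hc := two_mul_choose_two s
    have hR' : R = s + 2 := by omega
    rw [hR']
    have h1 : (s + 2) * A ≤ 4 * s * A2 := by nlinarith
    have h2 : (s + 2) * (s * Bl) ≤ 4 * (s.choose 2 * Bl) := by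
      have : (s + 2) * s ≤ 4 * s.choose 2 := by
        have h3 : 4 * s.choose 2 = 2 * (s * (s - 1)) := by omega
        rw [h3]
        have h5 : s + 2 ≤ 2 * (s - 1) := by omega
        calc (s + 2) * s ≤ 2 * (s - 1) * s := Nat.mul_le_mul_right s h5
          _ = 2 * (s * (s - 1)) := by ring
      calc (s + 2) * (s * Bl) = ((s + 2) * s) * Bl := by ring
        _ ≤ (4 * s.choose 2) * Bl := Nat.mul_le_mul_right Bl this
        _ = 4 * (s.choose 2 * Bl) := by ring
    calc (s + 2) * (A + s * Bl) = (s + 2) * A + (s + 2) * (s * Bl) := by ring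
      _ ≤ 4 * s * A2 + 4 * (s.choose 2 * Bl) := Nat.add_le_add h1 h2
      _ = 4 * (s * A2 + s.choose 2 * Bl) := by ring


/-- **THE ROW `(3, 4)` ON A RANK-`4` COLOOP-FREE MATROID WITH A PLANE OF `ν + 2` POINTS**: `ProfileIneqMinusQ N 3 4`
(the top threshold `t = 3 = 4 − 1` is the row, `thresholdIneq_iff_row`). -/
theorem profileIneqMinusQ_three_four_of_long_plane (hcf : ∀ z ∈ gr N, rk N ((gr N).erase z) = rk N (gr N))
    {B : Finset α} (hB : B ∈ Rq N 3) (hlong : (clF N B).card + rk N (gr N) = (gr N).card + 2)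
    (hR : rk N (gr N) = 4) : ProfileIneqMinusQ N 3 4 := by
  have h := thresholdIneq_four_top_of_long_plane hcf hB hlong (by omega)
  rw [hR] at h
  exact (thresholdIneq_iff_row (by norm_num)).1 h

/-- **The profile row `(Π_{3,4})` on a rank-`4` coloop-free matroid with a plane of `ν + 2` points.** -/
theorem profileIneq_three_four_of_long_plane (hcf : ∀ z ∈ gr N, rk N ((gr N).erase z) = rk N (gr N))
    {B : Finset α} (hB : B ∈ Rq N 3) (hlong : (clF N B).card + rk N (gr N) = (gr N).card + 2)
    (hR : rk N (gr N) = 4) : ProfileIneq N 3 4 :=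
  profileIneq_of_minusQ (by norm_num) (profileIneqMinusQ_three_four_of_long_plane hcf hB hlong hR)

/-- **`(★_4)` at the level `u = 5`** at a point `z` whose deletion is coloop-free of rank `6` with a plane of `ν + 2`
points (`t = 5 = 6 − 1` is the top threshold of `M ∖ z`). -/
theorem starQ_four_five_of_long_plane {M : Matroid α} [M.Finite] {z : α}
    (hcf : ∀ w ∈ gr (M ＼ ({z} : Set α)), rk (M ＼ ({z} : Set α)) ((gr (M ＼ ({z} : Set α))).erase w) =
      rk (M ＼ ({z} : Set α)) (gr (M ＼ ({z} : Set α))))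
    {B : Finset α} (hB : B ∈ Rq (M ＼ ({z} : Set α)) 3)
    (hlong : (clF (M ＼ ({z} : Set α)) B).card + rk (M ＼ ({z} : Set α)) (gr (M ＼ ({z} : Set α))) =
      (gr (M ＼ ({z} : Set α))).card + 2)
    (hR : rk (M ＼ ({z} : Set α)) (gr (M ＼ ({z} : Set α))) = 6) : StarQ M z 4 5 := by
  have h := thresholdIneq_four_top_of_long_plane hcf hB hlong (by omega)
  rw [hR] at h
  exact (starQ_succ_iff_thresholdIneq (by norm_num)).2 h

/-- **`(GM)_4` at a coloop `z` at the level `u = 5`** when `M ∖ z` is coloop-free of rank `6` with a plane of `ν + 2`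
points — the coloop band case of the hard rule's dispatch at co-rank `4` in this regime (`gapMonoQ_of_coloop_of_starQ`
with the trivial row `(4, 4)` of `M ∖ z`). -/
theorem gapMonoQ_coloop_four_five_of_long_plane {M : Matroid α} [M.Finite] {z : α} (hz : z ∈ gr M)
    (hzc : rk M ((gr M).erase z) + 1 = rk M (gr M))
    (hcf : ∀ w ∈ gr (M ＼ ({z} : Set α)), rk (M ＼ ({z} : Set α)) ((gr (M ＼ ({z} : Set α))).erase w) =
      rk (M ＼ ({z} : Set α)) (gr (M ＼ ({z} : Set α))))
    {B : Finset α} (hB : B ∈ Rq (M ＼ ({z} : Set α)) 3)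
    (hlong : (clF (M ＼ ({z} : Set α)) B).card + rk (M ＼ ({z} : Set α)) (gr (M ＼ ({z} : Set α))) =
      (gr (M ＼ ({z} : Set α))).card + 2)
    (hR : rk (M ＼ ({z} : Set α)) (gr (M ＼ ({z} : Set α))) = 6) : GapMonoQ M z 4 5 :=
  gapMonoQ_of_coloop_of_starQ hz hzc (by norm_num) (by norm_num)
    (profileIneqMinusQ_self (M ＼ ({z} : Set α)) 4) (starQ_four_five_of_long_plane hcf hB hlong hR)

end Complementation

end PercRepro.Cogirth
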